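import Summits.NavierStokesRegularity.NavierStokesRegularity.Theorems.ScenarioCensusRowF1InviscidLiouville
import Summits.NavierStokesRegularity.NavierStokesRegularity.Theorems.ScenarioCensusRowF1ColumnarTransfer
import Summits.NavierStokesRegularity.NavierStokesRegularity.Theorems.ScenarioCensusRowF1StretchedTransfer
import HarnessLib

/-!
# LINE «inviscid-top» port, part 4/5: the transfer — fast points, the second-order clock, analytic density (§5)

Re-homed for the scenario census (typer seat ns-census-typer-1 g8; the cells F1vfq ⊇ F1afq, F1vgq and the o-forms F1vf / F1vg / F1af are MEMBERS OF RECORD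
«DECIDED IN KERNEL IN FILES» of row F1 since census v1.71 (critic idea-crit-3 PASS 21:40:30Z; ref ns-census-ref g8 PRE-CHECK ✓ §13.14 item 17; lead-presearch
label); this port makes them TREE-decided): VERBATIM PORT of ns-idea-3 LINE 18 «inviscid-top», `pub/ideators/ns-idea-3/lines/inviscid-top/line-inviscid-top.lean`
sha16 75cdf592fc13b830 (1259 l., lean check rc 0, 0 sorry), split for the 400-line rule into `ScenarioCensusRowF1Inviscid` (§1–§2) → `…InviscidZoom` (§3) →
`…InviscidLiouville` (§4) → `…InviscidTransfer` (§5) → `…InviscidTop` (§6 + census KEYS).  Lean text VERBATIM in namespace `…Theorems.ScenarioCensus.InviscidTop`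
(the line's `…Cruxes.ScenarioCensusRowF1.InviscidTopLine` re-homed); port edits: `@[conjecture]` on the residual `LaplacianDefectSlack` (≡ `ScenarioCensus.Row_F1`,
OPEN), fifteen one-line docstrings added (gate lint).

No census VALUE is moved here (row F1 stays OPEN-WITH-LINE; the members become TREE-decided by name); NS regularity is NOT proved; `Row_F1` is
untouched (zero movement, `laplacianDefectSlack_iff_rowF1`); no summit statement is proved by this file. Lemmas that restate already-landed tree declarations are taken BY NAME (gate lint `dedup.landed`): `tendsto_physicalTime` = `ColumnarTop.tendsto_physicalTime`, `eventually_fast` = `ColumnarTop.eventually_fast`, `sqrt_timeLag` = `StretchedTop.sqrt_timeLag`, `forall_of_forall_ne_zero` = `StretchedTop.forall_of_forall_ne_zero`.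
-/

-- the summit and its single problem share the name `NavierStokesRegularity` (D-0017 nested layout)
set_option linter.dupNamespace false

noncomputable section

open MeasureTheory Set Function Filter TopologicalSpace Metric
open scoped Topology NNReal ENNReal InnerProductSpace RealInnerProductSpace Laplacian

namespace Summit.NavierStokesRegularity.NavierStokesRegularity.Theorems.ScenarioCensus.InviscidTop

open Literature.Analysis Literature.Analysis.FluidPDE
open Summit.NavierStokesRegularity.NavierStokesRegularity.Theorems

/-! ## §5 The transfer: fast points, the second-order clock, analytic density -/

-- `tendsto_physicalTime`: the line restates the tree's `ColumnarTop.tendsto_physicalTime`; taken BY NAME (gate lint dedup.landed).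

-- `sqrt_timeLag`: the line restates the tree's `StretchedTop.sqrt_timeLag`; taken BY NAME (gate lint dedup.landed).

-- `eventually_fast`: the line restates the tree's `ColumnarTop.eventually_fast`; taken BY NAME (gate lint dedup.landed).

/-- **The second-order clock identity**: `(c α)(c R)² · (−t)^{3/2} = √ν (T − τ_j)^{3/2}` under the
`M`-normalisation `α R = β`, `α √ν = √β` (the Hessian zoom weight is exactly the dimensionless physical weight). -/
theorem clock₂_eq {T ν t α β R : ℝ} (hα : 0 < α) (hβ : 0 < β) (hαR : α * R = β)
    (hαν : α * Real.sqrt ν = Real.sqrt β) (ht : t < 0) {c : ℕ → ℝ} (hcpos : ∀ j, 0 < c j) (j : ℕ) :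
    c j * α * (c j * R) * (c j * R) * ((-t) * Real.sqrt (-t)) = clock₂ ν T (T + c j ^ 2 * β * t) := by
  have hRν : R = Real.sqrt β * Real.sqrt ν := by
    have h1 : α * (Real.sqrt β * Real.sqrt ν) = α * R := by
      calc α * (Real.sqrt β * Real.sqrt ν) = (α * Real.sqrt ν) * Real.sqrt β := by ring
        _ = Real.sqrt β * Real.sqrt β := by rw [hαν]
        _ = β := Real.mul_self_sqrt hβ.le
        _ = α * R := hαR.symm
    exact (mul_left_cancel₀ hα.ne' h1).symm
  rw [clock₂, StretchedTop.sqrt_timeLag hβ ht hcpos j, show T - (T + c j ^ 2 * β * t) = c j ^ 2 * β * (-t) by ring]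
  calc c j * α * (c j * R) * (c j * R) * ((-t) * Real.sqrt (-t))
      = c j ^ 3 * (α * R) * R * ((-t) * Real.sqrt (-t)) := by ring
    _ = c j ^ 3 * β * (Real.sqrt β * Real.sqrt ν) * ((-t) * Real.sqrt (-t)) := by rw [hαR, ← hRν]
    _ = Real.sqrt ν * (c j ^ 2 * β * (-t) * (c j * Real.sqrt β * Real.sqrt (-t))) := by ring

/-- **HESSIAN TRANSFER**: for a continuous read-out `Rd` of the Hessian, positively homogeneous
(`Rd (a H) = a Rd H`, `a ≥ 0`), the physical bound «`√ν (T − t')^{3/2} Rd(∇²u(t', x)) ≤ ε` at the `Λ t'`-fast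
points, eventually» passes to «`(−t)^{3/2} Rd(∇²W(t, y)) ≤ ε` at every `y` with `W(t, y) ≠ 0`». -/
theorem hessian_transfer {T ν ε : ℝ} {u : ℝ → E3 → E3} {x₀ : E3} {α β R : ℝ} {c : ℕ → ℝ}
    {W : ℝ → E3 → E3}
    (hα : 0 < α) (hβ : 0 < β) (hαR : α * R = β) (hαν : α * Real.sqrt ν = Real.sqrt β)
    (hcpos : ∀ j, 0 < c j) (hclim : Tendsto c atTop (𝓝 0))
    (hpt : ∀ t < 0, ∀ y : E3,
      Tendsto (fun j => (c j * α) • u (T + c j ^ 2 * β * t) (x₀ + (c j * R) • y)) atTop (𝓝 (W t y)))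
    (hhess : ∀ t < 0, ∀ y : E3,
      Tendsto (fun j => (c j * α * (c j * R) * (c j * R)) •
          fderiv ℝ (fderiv ℝ (u (T + c j ^ 2 * β * t))) (x₀ + (c j * R) • y))
        atTop (𝓝 (fderiv ℝ (fderiv ℝ (W t)) y)))
    {Rd : Hess → ℝ} (hRc : Continuous Rd) (hRh : ∀ a : ℝ, 0 ≤ a → ∀ H, Rd (a • H) = a * Rd H)
    {Λ : ℝ → ℝ} (hΛ : IsSubcriticalLevel T Λ)
    (hH : ∀ᶠ t' in 𝓝[<] T, ∀ x : E3, Λ t' < ‖u t' x‖ →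
      clock₂ ν T t' * Rd (fderiv ℝ (fderiv ℝ (u t')) x) ≤ ε) :
    ∀ t < 0, ∀ y, W t y ≠ 0 → (-t) * Real.sqrt (-t) * Rd (fderiv ℝ (fderiv ℝ (W t)) y) ≤ ε := by
  intro t ht y hne
  have hlim := ((hRc.tendsto _).comp (hhess t ht y)).const_mul ((-t) * Real.sqrt (-t))
  have hfast := ColumnarTop.eventually_fast hα hβ hcpos hclim hpt hΛ ht hne
  have hτ := ColumnarTop.tendsto_physicalTime (T := T) hβ ht hcpos hclim
  refine le_of_tendsto hlim ?_
  filter_upwards [hfast, hτ.eventually hH] with j hj1 hj2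
  have hb := hj2 _ hj1
  have hw : 0 ≤ c j * α * (c j * R) * (c j * R) := by
    have hR : 0 < R := by
      have : 0 < α * R := by rw [hαR]; exact hβ
      exact pos_of_mul_pos_right this hα.le
    have := hcpos j
    positivity
  rw [Function.comp_apply, hRh _ hw, ← mul_assoc, mul_comm ((-t) * Real.sqrt (-t)),
    clock₂_eq hα hβ hαR hαν ht hcpos j]
  exact hb

-- `forall_of_forall_ne_zero`: the line restates the tree's `StretchedTop.forall_of_forall_ne_zero`; taken BY NAME (gate lint dedup.landed).

/-- **Hessian conditions globalise**: a closed condition on `∇²W(s, ·)` holding on `{W(s, ·) ≠ 0}` and at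
`H = 0` holds everywhere (analytic density on nontrivial slices; `∇²W(s, ·) = 0` on trivial ones). -/
theorem hessCond_everywhere {C : ℝ} {W : ℝ → E3 → E3} (hW : IsTypeIAncientMild C W)
    {P : ℝ → Hess → Prop} (hPc : ∀ w : ℝ, IsClosed {H : Hess | P w H})
    (hP0 : ∀ w : ℝ, P w 0) (h : ∀ s < 0, ∀ y, W s y ≠ 0 → P (-s) (fderiv ℝ (fderiv ℝ (W s)) y)) :
    ∀ s < 0, ∀ y, P (-s) (fderiv ℝ (fderiv ℝ (W s)) y) := by
  intro s hs y
  by_cases hnt : ∃ z, W s z ≠ 0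
  · have hcont : Continuous fun y => fderiv ℝ (fderiv ℝ (W s)) y :=
      ((hW.contDiff_slice hs).fderiv_right (m := 1) (by norm_cast)).continuous_fderiv (by norm_num)
    have hS : IsClosed {y : E3 | P (-s) (fderiv ℝ (fderiv ℝ (W s)) y)} := (hPc (-s)).preimage hcont
    exact StretchedTop.forall_of_forall_ne_zero hW hs hS (fun y hy => h s hs y hy) hnt y
  · push Not at hnt
    have h0 : W s = fun _ => (0 : E3) := funext hnt
    have h1 : fderiv ℝ (W s) = fun _ => (0 : E3 →L[ℝ] E3) := by
      funext z; rw [h0, fderiv_const_apply]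
    rw [h1, fderiv_const_apply]
    exact hP0 (-s)

/-- **The full second-order transfer**: an ε-defect of a nonnegative homogeneous continuous Hessian read-out on
the top passes to the bound `(−s)^{3/2} Rd(∇²W(s, y)) ≤ ε` at EVERY point of the open past of the zoom limit. -/
theorem hessian_transfer_everywhere {T ν ε M : ℝ} {u : ℝ → E3 → E3} {x₀ : E3} {α β R : ℝ} {c : ℕ → ℝ}
    {W : ℝ → E3 → E3} (hW : IsTypeIAncientMild M W)
    (hα : 0 < α) (hβ : 0 < β) (hαR : α * R = β) (hαν : α * Real.sqrt ν = Real.sqrt β)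
    (hcpos : ∀ j, 0 < c j) (hclim : Tendsto c atTop (𝓝 0))
    (hpt : ∀ t < 0, ∀ y : E3,
      Tendsto (fun j => (c j * α) • u (T + c j ^ 2 * β * t) (x₀ + (c j * R) • y)) atTop (𝓝 (W t y)))
    (hhess : ∀ t < 0, ∀ y : E3,
      Tendsto (fun j => (c j * α * (c j * R) * (c j * R)) •
          fderiv ℝ (fderiv ℝ (u (T + c j ^ 2 * β * t))) (x₀ + (c j * R) • y))
        atTop (𝓝 (fderiv ℝ (fderiv ℝ (W t)) y)))
    {Rd : Hess → ℝ} (hRc : Continuous Rd) (hRh : ∀ a : ℝ, 0 ≤ a → ∀ H, Rd (a • H) = a * Rd H)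
    (hR0 : Rd 0 = 0) (hε : 0 ≤ ε) {Λ : ℝ → ℝ} (hΛ : IsSubcriticalLevel T Λ)
    (hH : ∀ᶠ t' in 𝓝[<] T, ∀ x : E3, Λ t' < ‖u t' x‖ →
      clock₂ ν T t' * Rd (fderiv ℝ (fderiv ℝ (u t')) x) ≤ ε) :
    ∀ s < 0, ∀ y, (-s) * Real.sqrt (-s) * Rd (fderiv ℝ (fderiv ℝ (W s)) y) ≤ ε := by
  have hPc : ∀ w : ℝ, IsClosed {H : Hess | w * Real.sqrt w * Rd H ≤ ε} := fun w =>
    isClosed_le (continuous_const.mul hRc) continuous_const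
  exact hessCond_everywhere hW (P := fun w H => w * Real.sqrt w * Rd H ≤ ε) hPc
    (fun w => by show w * Real.sqrt w * Rd 0 ≤ ε; rw [hR0, mul_zero]; exact hε)
    (hessian_transfer hα hβ hαR hαν hcpos hclim hpt hhess hRc hRh hΛ hH)

end Summit.NavierStokesRegularity.NavierStokesRegularity.Theorems.ScenarioCensus.InviscidTop

end
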